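import Summits.CriticalPhenomena.PercolationContinuityZ3.Theorems.SahiBoxTP2CellFKG
import Literature.Probability.LatticeModels.Affiliation
import Mathlib.MeasureTheory.Constructions.BorelSpace.Metric
import Mathlib.MeasureTheory.Measure.Regular

/-!
# Box-TP₂ ⟺ set-TP₂ ⟹ affiliated, for ARBITRARY (singular) probability measures on `Q_d`

Support file of the Sahi cell (`prim-sahi`, typer seat, generation 12; `--supports stmt-CriticalPhenomena-4575`).

Müller–Stoyan's Theorem 3.10.14 ((i) MTP₂ density ⟺ (ii) set-TP₂ `μ(A)μ(B) ≤ μ(A ⊼ B)μ(A ⊻ B)` ⟺ (iii)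
affiliated, Milgrom–Weber 1982) is printed FOR LAWS WITH A DENSITY; the tree has the finite/density layers
(`Literature.Probability.LatticeModels.Affiliation`: `isSetTP2_of_isFKGMeasure`, `mIsSetTP2.mIsAffiliated`,
`mIsSetTP2.icc`, `mIsSetTP2_withDensity_pi`).  For a SINGULAR law the density-free notion of generation 11 is
box-TP₂ = (ii) restricted to closed order intervals.  This file closes the circle for every probability measure on
the unit cube `Q_d = (Fin d → [0,1])`:

* `IsBoxTP2.measure_mul_le_of_isClosed` — for CLOSED `A, B`: `μ(A)μ(B) ≤ μ(A ⊼ B)μ(A ⊻ B)` (discretise at level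
  `m`: the cell weight is an FKG weight, `IsBoxTP2.isFKGMeasure_cubeCellWeight`, hence set-TP₂ by the four functions
  theorem; the cells meeting `A` have mass `↓ μ(A)` and the joins of cells meeting `A` and `B` lie within `1/(m+1)` of
  the compact set `A ⊻ B`, `tendsto_measure_cthickening_of_isClosed`).
* **`IsBoxTP2.mIsSetTP2`** — by inner regularity, (ii) for ALL measurable `A, B` (outer measure on the image sets):
  **box-TP₂ ⟺ set-TP₂** (`isBoxTP2_iff_mIsSetTP2`), and hence **box-TP₂ ⟹ affiliated** in Milgrom–Weber's sense
  (`IsBoxTP2.mIsAffiliated`: every conditional law on a measurable sublattice is positively associated) — with no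
  density, continuity or support hypothesis.

[cite: MullerStoyan2002, Thm. 3.10.14; MilgromWeber1982, Appendix; KarlinRinott1980, Thm. 2.1] for the density case;
the singular case is this work.  No sorries, no new axioms.
-/

noncomputable section

namespace Summit.CriticalPhenomena.PercolationContinuityZ3.Theorems.SahiBoxTP2

open MeasureTheory ProbabilityTheory Set Filter Topology Function Metric Literature.Combinatorics.Sahi2008
open Literature.Combinatorics.Sahi2008.LebesgueSquare (gridPt cellIdx)
open Literature.Combinatorics.Sahi2008.LebesgueCube (cubeCell measurable_cubeCell cubeCell_mono loCube hiCube
  loCube_cubeCell_le le_hiCube_cubeCell)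
open Summit.CriticalPhenomena.PercolationContinuityZ3.Theorems.SahiCubeDensity (cubeCellWeight cubeCell_inf
  cubeCell_sup)
open Literature.Probability.LatticeModels.Affiliation (IsSetTP2 mIsSetTP2 mIsAffiliated isSetTP2_of_isFKGMeasure)
open scoped ENNReal unitInterval FinsetFamily SetFamily

variable {d m : ℕ}

/-! ### Cells are small -/

/-- **Two points in the same cell are `1/(m+1)`-close** (sup metric). [folklore] -/
theorem dist_le_of_cubeCell_eq {x y : Fin d → I} (h : cubeCell m x = cubeCell m y) :
    dist x y ≤ 1 / ((m : ℝ) + 1) := by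
  have hm : (0 : ℝ) < (m : ℝ) + 1 := by positivity
  refine (dist_pi_le_iff (by positivity)).2 fun j => ?_
  -- both coordinates lie in `[lo, hi]` with `hi - lo = 1/(m+1)`
  set c := cubeCell m x with hc
  have hxlo : loCube m c j ≤ x j := loCube_cubeCell_le x j
  have hxhi : x j ≤ hiCube m c j := le_hiCube_cubeCell x j
  have hylo : loCube m c j ≤ y j := by rw [h]; exact loCube_cubeCell_le y j
  have hyhi : y j ≤ hiCube m c j := by rw [h]; exact le_hiCube_cubeCell y j
  have hlo : ((loCube m c j : I) : ℝ) = ((c j : ℕ) : ℝ) / ((m + 1 : ℕ) : ℝ) :=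
    coe_gridPt_eq_div (Nat.succ_pos m) (Nat.le_succ_of_le (Nat.le_of_lt_succ (c j).2))
  have hhi : ((hiCube m c j : I) : ℝ) = (((c j : ℕ) + 1 : ℕ) : ℝ) / ((m + 1 : ℕ) : ℝ) :=
    coe_gridPt_eq_div (Nat.succ_pos m) (Nat.succ_le_succ (Nat.le_of_lt_succ (c j).2))
  have hxlo' := Subtype.coe_le_coe.2 hxlo; have hxhi' := Subtype.coe_le_coe.2 hxhi
  have hylo' := Subtype.coe_le_coe.2 hylo; have hyhi' := Subtype.coe_le_coe.2 hyhi
  rw [hlo] at hxlo' hylo'; rw [hhi] at hxhi' hyhi'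
  rw [Subtype.dist_eq, Real.dist_eq, abs_sub_le_iff]
  push_cast at hxlo' hylo' hxhi' hyhi' ⊢
  have hgap : (((c j : ℕ) : ℝ) + 1) / ((m : ℝ) + 1) - ((c j : ℕ) : ℝ) / ((m : ℝ) + 1) = 1 / ((m : ℝ) + 1) := by
    field_simp; ring
  constructor <;> linarith

/-! ### The cells meeting a set -/

section Cells

variable (μ : Measure (Fin d → I))

open Classical in
/-- The (finite) set of level-`m` cells meeting `A`. -/
def cellsMeeting (m : ℕ) (A : Set (Fin d → I)) : Finset (Fin d → Fin (m + 1)) :=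
  Finset.univ.filter fun c => ∃ a ∈ A, cubeCell m a = c

/-- Membership in `cellsMeeting`. [folklore] -/
theorem mem_cellsMeeting {A : Set (Fin d → I)} {c : Fin d → Fin (m + 1)} :
    c ∈ cellsMeeting m A ↔ ∃ a ∈ A, cubeCell m a = c := by
  classical
  simp only [cellsMeeting, Finset.mem_filter, Finset.mem_univ, true_and]

/-- `A` is covered by its cells. [folklore] -/
theorem subset_preimage_cellsMeeting (A : Set (Fin d → I)) : A ⊆ cubeCell m ⁻¹' ↑(cellsMeeting m A) :=
  fun a ha => by simpa only [mem_preimage, Finset.mem_coe, mem_cellsMeeting] using ⟨a, ha, rfl⟩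

/-- The union of the cells meeting `A` lies within `1/(m+1)` of `A`. [folklore] -/
theorem preimage_cellsMeeting_subset_cthickening (A : Set (Fin d → I)) :
    cubeCell m ⁻¹' ↑(cellsMeeting m A) ⊆ cthickening (1 / ((m : ℝ) + 1)) A := by
  intro x hx
  simp only [mem_preimage, Finset.mem_coe, mem_cellsMeeting] at hx
  obtain ⟨a, ha, hax⟩ := hx
  exact mem_cthickening_of_dist_le x a _ A ha (dist_le_of_cubeCell_eq hax.symm)

/-- **Joins of cells**: the cells of `cellsMeeting A ⊻ cellsMeeting B` lie within `1/(m+1)` of `A ⊻ B` (the cell map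
is a lattice homomorphism). [this work] -/
theorem preimage_cellsMeeting_sups_subset (A B : Set (Fin d → I)) :
    cubeCell m ⁻¹' ↑(cellsMeeting m A ⊻ cellsMeeting m B) ⊆ cthickening (1 / ((m : ℝ) + 1)) (A ⊻ B) := by
  intro x hx
  simp only [mem_preimage, Finset.mem_coe, Finset.mem_sups, mem_cellsMeeting] at hx
  obtain ⟨c, ⟨a, ha, rfl⟩, c', ⟨b, hb, rfl⟩, hx⟩ := hx
  rw [← cubeCell_sup] at hx
  exact mem_cthickening_of_dist_le x (a ⊔ b) _ _ (Set.mem_sups.2 ⟨a, ha, b, hb, rfl⟩)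
    (dist_le_of_cubeCell_eq hx.symm)

/-- **Meets of cells**: likewise for `⊼` and `A ⊼ B`. [this work] -/
theorem preimage_cellsMeeting_infs_subset (A B : Set (Fin d → I)) :
    cubeCell m ⁻¹' ↑(cellsMeeting m A ⊼ cellsMeeting m B) ⊆ cthickening (1 / ((m : ℝ) + 1)) (A ⊼ B) := by
  intro x hx
  simp only [mem_preimage, Finset.mem_coe, Finset.mem_infs, mem_cellsMeeting] at hx
  obtain ⟨c, ⟨a, ha, rfl⟩, c', ⟨b, hb, rfl⟩, hx⟩ := hx
  rw [← cubeCell_inf] at hx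
  exact mem_cthickening_of_dist_le x (a ⊓ b) _ _ (Set.mem_infs.2 ⟨a, ha, b, hb, rfl⟩)
    (dist_le_of_cubeCell_eq hx.symm)

/-- The mass of a union of cells, in `ℝ≥0∞`, is the cell-weight sum. [folklore] -/
theorem measure_cubeCell_preimage_eq_ofReal_sum [IsFiniteMeasure μ] (S : Finset (Fin d → Fin (m + 1))) :
    μ (cubeCell m ⁻¹' ↑S) = ENNReal.ofReal (∑ c ∈ S, cubeCellWeight μ m c) := by
  rw [← measureReal_cubeCell_preimage μ S, measureReal_def, ENNReal.ofReal_toReal (measure_ne_top μ _)]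

/-- **The discrete step**: for a box-TP₂ probability measure,
`μ(cells(A)) μ(cells(B)) ≤ μ(cells(A) ⊼ cells(B)) μ(cells(A) ⊻ cells(B))` (set-TP₂ of the FKG cell weight).
[this work] -/
theorem IsBoxTP2.measure_cells_mul_le [IsProbabilityMeasure μ] (hμ : IsBoxTP2 μ) (A B : Set (Fin d → I)) :
    μ (cubeCell m ⁻¹' ↑(cellsMeeting m A)) * μ (cubeCell m ⁻¹' ↑(cellsMeeting m B)) ≤
      μ (cubeCell m ⁻¹' ↑(cellsMeeting m A ⊼ cellsMeeting m B)) *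
        μ (cubeCell m ⁻¹' ↑(cellsMeeting m A ⊻ cellsMeeting m B)) := by
  classical
  have hw : IsFKGMeasure (cubeCellWeight μ m) := hμ.isFKGMeasure_cubeCellWeight μ m
  have h := isSetTP2_of_isFKGMeasure hw (cellsMeeting m A) (cellsMeeting m B)
  have h0 : ∀ S : Finset (Fin d → Fin (m + 1)), 0 ≤ ∑ c ∈ S, cubeCellWeight μ m c :=
    fun S => Finset.sum_nonneg fun c _ => hw.nonneg c
  rw [measure_cubeCell_preimage_eq_ofReal_sum, measure_cubeCell_preimage_eq_ofReal_sum,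
    measure_cubeCell_preimage_eq_ofReal_sum, measure_cubeCell_preimage_eq_ofReal_sum,
    ← ENNReal.ofReal_mul (h0 _), ← ENNReal.ofReal_mul (h0 _)]
  exact ENNReal.ofReal_le_ofReal h

end Cells

/-! ### Set-TP₂ for closed sets, then for all measurable sets -/

section SetTP2

variable (μ : Measure (Fin d → I))

/-- `1/(m+1) → 0`, in the form fed to `tendsto_measure_cthickening_of_isClosed`. [folklore] -/
theorem tendsto_one_div_succ : Tendsto (fun m : ℕ => 1 / ((m : ℝ) + 1)) atTop (𝓝 0) :=
  tendsto_one_div_add_atTop_nhds_zero_nat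

/-- Masses of shrinking closed thickenings of a closed set converge to its mass. [folklore] -/
theorem tendsto_measure_cthickening_succ [IsFiniteMeasure μ] {C : Set (Fin d → I)} (hC : IsClosed C) :
    Tendsto (fun m : ℕ => μ (cthickening (1 / ((m : ℝ) + 1)) C)) atTop (𝓝 (μ C)) :=
  (tendsto_measure_cthickening_of_isClosed ⟨1, one_pos, measure_ne_top μ _⟩ hC).comp tendsto_one_div_succ

/-- Joins of compact sets are compact (continuity of `⊔` on the cube). [folklore] -/
theorem isCompact_sups {A B : Set (Fin d → I)} (hA : IsCompact A) (hB : IsCompact B) : IsCompact (A ⊻ B) := by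
  rw [← Set.image_sup_prod, ← Set.image_uncurry_prod]
  refine (hA.prod hB).image (continuous_pi fun j => ?_)
  exact ((continuous_apply j).comp continuous_fst).max ((continuous_apply j).comp continuous_snd)

/-- Meets of compact sets are compact. [folklore] -/
theorem isCompact_infs {A B : Set (Fin d → I)} (hA : IsCompact A) (hB : IsCompact B) : IsCompact (A ⊼ B) := by
  rw [← Set.image_inf_prod, ← Set.image_uncurry_prod]
  refine (hA.prod hB).image (continuous_pi fun j => ?_)
  exact ((continuous_apply j).comp continuous_fst).min ((continuous_apply j).comp continuous_snd)

/-- **Set-TP₂ for closed sets**: for a box-TP₂ probability measure on `Q_d` and closed `A, B`,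
`μ(A) μ(B) ≤ μ(A ⊼ B) μ(A ⊻ B)`. [this work] -/
theorem IsBoxTP2.measure_mul_le_of_isClosed [IsProbabilityMeasure μ] (hμ : IsBoxTP2 μ) {A B : Set (Fin d → I)}
    (hA : IsClosed A) (hB : IsClosed B) : μ A * μ B ≤ μ (A ⊼ B) * μ (A ⊻ B) := by
  have hAB₁ : IsClosed (A ⊼ B) := (isCompact_infs hA.isCompact hB.isCompact).isClosed
  have hAB₂ : IsClosed (A ⊻ B) := (isCompact_sups hA.isCompact hB.isCompact).isClosed
  refine ge_of_tendsto' (ENNReal.Tendsto.mul (tendsto_measure_cthickening_succ μ hAB₁) (Or.inr (measure_ne_top μ _))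
    (tendsto_measure_cthickening_succ μ hAB₂) (Or.inr (measure_ne_top μ _))) fun m => ?_
  calc μ A * μ B ≤ μ (cubeCell m ⁻¹' ↑(cellsMeeting m A)) * μ (cubeCell m ⁻¹' ↑(cellsMeeting m B)) :=
        mul_le_mul' (measure_mono (subset_preimage_cellsMeeting A)) (measure_mono (subset_preimage_cellsMeeting B))
    _ ≤ μ (cubeCell m ⁻¹' ↑(cellsMeeting m A ⊼ cellsMeeting m B)) *
          μ (cubeCell m ⁻¹' ↑(cellsMeeting m A ⊻ cellsMeeting m B)) := hμ.measure_cells_mul_le μ A B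
    _ ≤ μ (cthickening (1 / ((m : ℝ) + 1)) (A ⊼ B)) * μ (cthickening (1 / ((m : ℝ) + 1)) (A ⊻ B)) :=
        mul_le_mul' (measure_mono (preimage_cellsMeeting_infs_subset A B))
          (measure_mono (preimage_cellsMeeting_sups_subset A B))

/-- **BOX-TP₂ ⟹ SET-TP₂** (Müller–Stoyan's (ii), no density): for every box-TP₂ probability measure on `Q_d` and all
measurable `A, B`, `μ(A) μ(B) ≤ μ(A ⊼ B) μ(A ⊻ B)` (image sets measured by outer measure; inner regularity by closed
sets). [this work] -/
theorem IsBoxTP2.mIsSetTP2 [IsProbabilityMeasure μ] (hμ : IsBoxTP2 μ) : mIsSetTP2 μ := by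
  intro A B hA hB
  rw [hA.measure_eq_iSup_isClosed_of_ne_top (measure_ne_top μ A),
    hB.measure_eq_iSup_isClosed_of_ne_top (measure_ne_top μ B), ENNReal.iSup_mul]
  refine iSup_le fun K => ?_
  rw [ENNReal.iSup_mul]
  refine iSup_le fun hKA => ?_
  rw [ENNReal.iSup_mul]
  refine iSup_le fun hK => ?_
  rw [ENNReal.mul_iSup]
  refine iSup_le fun L => ?_
  rw [ENNReal.mul_iSup]
  refine iSup_le fun hLB => ?_
  rw [ENNReal.mul_iSup]
  refine iSup_le fun hL => ?_
  exact (hμ.measure_mul_le_of_isClosed μ hK hL).trans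
    (mul_le_mul' (measure_mono (Set.infs_subset hKA hLB)) (measure_mono (Set.sups_subset hKA hLB)))

/-- **BOX-TP₂ ⟺ SET-TP₂** for probability measures on the unit cube. [this work] -/
theorem isBoxTP2_iff_mIsSetTP2 [IsProbabilityMeasure μ] : IsBoxTP2 μ ↔ mIsSetTP2 μ :=
  ⟨fun hμ => hμ.mIsSetTP2 μ, fun h a b a' b' => h.icc a b a' b'⟩

/-- **BOX-TP₂ ⟹ AFFILIATED (Milgrom–Weber)**: every conditional law of a box-TP₂ probability measure on `Q_d` on
a measurable sublattice is positively associated, `μ(A ∩ L) μ(B ∩ L) ≤ μ(A ∩ B ∩ L) μ(L)` for measurable upper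
`A, B` — singular laws included. [this work] -/
theorem IsBoxTP2.mIsAffiliated [IsProbabilityMeasure μ] (hμ : IsBoxTP2 μ) : mIsAffiliated μ :=
  (hμ.mIsSetTP2 μ).mIsAffiliated

end SetTP2

end Summit.CriticalPhenomena.PercolationContinuityZ3.Theorems.SahiBoxTP2
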